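import Summits.AtomisticToContinuum.BoseEinsteinCondensation.Theorems.BECConjugateDominationInfraredMinimumUncertaintyStein

/-!
# Route `BECConjugateDomination`, crux `InfraredMinimumUncertainty` (stmt-AtomisticToContinuum-11784),
# line `fisher-gaussian-density-mode`: the Stein identity and the derivative-free form of `J_m(φ)`

Supports (does not close) stmt-AtomisticToContinuum-11784; NEW (line lead). Assembly of the per-particle
Stein step of `…Stein.lean` over the particles, for a real-valued periodic `C¹` state:

* `stein_identity`: `∫ conj(φ(Z_m)) W_m conj(Ψ) dX = ‖k‖² ( N ∫ conj(∂φ(Z_m)) |Ψ|² − ∫ conj(∂̄φ(Z_m)) Z_{2m} |Ψ|² )`;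
* `fisherTestV_eq_stein` (`m ≠ 0`):
  `J_m(φ) = −4 Re ∫ conj(∂φ(Z_m)) |Ψ|² + (4/N) Re ∫ conj(∂̄φ(Z_m)) Z_{2m} |Ψ|² − ∫ |φ(Z_m)|² |Ψ|²`.

So the lifted Fisher test functional — hence both registered stubs FD (`16 ν_m ≤ C J_m(φ)`) and FG
(`J_m(φ)·N S_m ≤ C`) — sees the state ONLY through `ν_m` and the JOINT LAW of the first two harmonics
`(Z_m, Z_{2m})` under `|Ψ|² dX`; no derivative of `Ψ` survives. (`φ = −λz` recovers the Cramér–Rao rung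
`J = 4λ − λ² N S_m`; `φ = −λz̄` tests `E[Z_{2m}]`.) Wirtinger derivatives are written out:
`∂φ(z) = (Dφ(z)·1 − i Dφ(z)·i)/2`, `∂̄φ(z) = (Dφ(z)·1 + i Dφ(z)·i)/2`.

References: C. Stein, Proc. Sixth Berkeley Symp. 2 (1972) 583; A. J. Stam, Inform. Control 2 (1959) 101.
-/

noncomputable section

open MeasureTheory Filter Set Metric
open scoped ENNReal NNReal Topology ComplexConjugate BigOperators

namespace Summit.AtomisticToContinuum.BoseEinsteinCondensation.Cruxes.InfraredMinimumUncertainty.FisherGaussianDensityMode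

open Literature.MathematicalPhysics.QuantumManyBody.BoseGas

section SteinForm

variable {N : ℕ}

/-- A real-valued `C¹` amplitude: `Ψ = u` with `u = Re Ψ`, and its derivative is real. -/
theorem realAmp_eq {L : ℝ} (Ψ : PeriodicTrialState N L) (hreal : ∀ X, Ψ.ψ X = (‖Ψ.ψ X‖ : ℂ)) (X : Config N) :
    Ψ.ψ X = (((Ψ.ψ X).re : ℝ) : ℂ) := by
  calc Ψ.ψ X = ((‖Ψ.ψ X‖ : ℝ) : ℂ) := hreal X
    _ = ((((‖Ψ.ψ X‖ : ℝ) : ℂ).re : ℝ) : ℂ) := by rw [Complex.ofReal_re]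
    _ = (((Ψ.ψ X).re : ℝ) : ℂ) := by rw [← hreal X]

/-- The real amplitude `Re Ψ` is `C¹`. -/
theorem contDiff_realAmp {L : ℝ} (Ψ : PeriodicTrialState N L) : ContDiff ℝ 1 fun X => (Ψ.ψ X).re := by
  have h₀ := Complex.reCLM.contDiff.comp Ψ.contDiff
  exact h₀

/-- The real amplitude `Re Ψ` is lattice periodic. -/
theorem realAmp_periodic {L : ℝ} (Ψ : PeriodicTrialState N L) : IsLatticePeriodic L fun X => (Ψ.ψ X).re :=
  fun X i c => by
    show (Ψ.ψ (X + Pi.single i (EuclideanSpace.single c L))).re = (Ψ.ψ X).re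
    rw [Ψ.periodic X i c]

/-- The derivative of a real-valued amplitude is the (real) derivative of `Re Ψ`. -/
theorem fderiv_realAmp {L : ℝ} (Ψ : PeriodicTrialState N L) (hreal : ∀ X, Ψ.ψ X = (‖Ψ.ψ X‖ : ℂ))
    (X v : Config N) : fderiv ℝ Ψ.ψ X v = ((fderiv ℝ (fun Y => (Ψ.ψ Y).re) X v : ℝ) : ℂ) := by
  have hu_cd := contDiff_realAmp Ψ
  have hfun : Ψ.ψ = fun Y => (((Ψ.ψ Y).re : ℝ) : ℂ) := funext (realAmp_eq Ψ hreal)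
  have h₁ := Complex.ofRealCLM.hasFDerivAt.comp X ((hu_cd.differentiable one_ne_zero) X).hasFDerivAt
  have h₂ : HasFDerivAt Ψ.ψ (Complex.ofRealCLM.comp (fderiv ℝ (fun Y => (Ψ.ψ Y).re) X)) X := by
    rw [hfun]; exact h₁
  rw [h₂.fderiv, ContinuousLinearMap.comp_apply, Complex.ofRealCLM_apply]

/-- `|Ψ|² = (Re Ψ)²` for a real-valued amplitude. -/
theorem norm_sq_realAmp {L : ℝ} (Ψ : PeriodicTrialState N L) (hreal : ∀ X, Ψ.ψ X = (‖Ψ.ψ X‖ : ℂ))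
    (X : Config N) : ‖Ψ.ψ X‖ ^ 2 = (Ψ.ψ X).re ^ 2 := by
  conv_lhs => rw [realAmp_eq Ψ hreal X]
  rw [Complex.norm_real, Real.norm_eq_abs, sq_abs]

/-- **The Stein identity for the lifted pairing** (real periodic `C¹` state, `C¹` test field):
`∫ conj(φ(Z_m)) W_m conj(Ψ) = ‖k‖² ( N ∫ conj(∂φ(Z_m)) |Ψ|² − ∫ conj(∂̄φ(Z_m)) Z_{2m} |Ψ|² )`. -/
theorem stein_identity {L : ℝ} (hL : 0 < L) (Ψ : PeriodicTrialState N L)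
    (hreal : ∀ X, Ψ.ψ X = (‖Ψ.ψ X‖ : ℂ)) {φ : ℂ → ℂ} (hφ : ContDiff ℝ 1 φ) (m : Fin 3 → ℤ) :
    ∫ X in cellN N L, starRingEnd ℂ (φ (densityMode N L m X)) * commutatorAmp N L Ψ.ψ m X *
        starRingEnd ℂ (Ψ.ψ X) =
      ((‖waveVec L m‖ ^ 2 : ℝ) : ℂ) *
        ((N : ℂ) * (∫ X in cellN N L, starRingEnd ℂ (((fderiv ℝ φ (densityMode N L m X) 1 - Complex.I * fderiv ℝ φ (densityMode N L m X) Complex.I) / 2)) *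
            ((‖Ψ.ψ X‖ ^ 2 : ℝ) : ℂ)) -
          ∫ X in cellN N L, starRingEnd ℂ (((fderiv ℝ φ (densityMode N L m X) 1 + Complex.I * fderiv ℝ φ (densityMode N L m X) Complex.I) / 2)) *
            densityMode N L ((2 : ℕ) • m) X * ((‖Ψ.ψ X‖ ^ 2 : ℝ) : ℂ)) := by
  set u : Config N → ℝ := fun X => (Ψ.ψ X).re with hudef
  have hψu : ∀ X, Ψ.ψ X = ((u X : ℝ) : ℂ) := realAmp_eq Ψ hreal
  have hu_cd : ContDiff ℝ 1 u := contDiff_realAmp Ψ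
  have hu_per : IsLatticePeriodic L u := realAmp_periodic Ψ
  have hderiv : ∀ X v, fderiv ℝ Ψ.ψ X v = ((fderiv ℝ u X v : ℝ) : ℂ) := fderiv_realAmp Ψ hreal
  have hnorm : ∀ X, ((‖Ψ.ψ X‖ ^ 2 : ℝ) : ℂ) = ((u X ^ 2 : ℝ) : ℂ) := fun X => by
    rw [norm_sq_realAmp Ψ hreal X]
  simp_rw [hnorm]
  -- pointwise expansion of the integrand as a sum over particles
  have hpt : ∀ X, starRingEnd ℂ (φ (densityMode N L m X)) * commutatorAmp N L Ψ.ψ m X *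
        starRingEnd ℂ (Ψ.ψ X) =
      ∑ j : Fin N, starRingEnd ℂ (φ (densityMode N L m X)) *
        (cellWave L m (X j) * (((‖waveVec L m‖ ^ 2 : ℝ) : ℂ) * ((u X : ℝ) : ℂ) -
          2 * Complex.I * ((fderiv ℝ u X (Pi.single j (waveVec L m)) : ℝ) : ℂ))) * ((u X : ℝ) : ℂ) := by
    intro X
    unfold commutatorAmp
    rw [Finset.mul_sum, Finset.sum_mul]
    refine Finset.sum_congr rfl fun j _ => ?_
    rw [hderiv, ← hψu X, hψu X, Complex.conj_ofReal]
  simp_rw [hpt]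
  -- integrate termwise
  have hZc := continuous_densityMode N L m
  have huc : Continuous u := hu_cd.continuous
  have hint : ∀ j : Fin N, Integrable (fun X : Config N => starRingEnd ℂ (φ (densityMode N L m X)) *
        (cellWave L m (X j) * (((‖waveVec L m‖ ^ 2 : ℝ) : ℂ) * ((u X : ℝ) : ℂ) -
          2 * Complex.I * ((fderiv ℝ u X (Pi.single j (waveVec L m)) : ℝ) : ℂ))) * ((u X : ℝ) : ℂ))
      (volume.restrict (cellN N L)) := by
    intro j
    refine integrableOn_cellN ?_ L
    have hec : Continuous fun Y : Config N => cellWave L m (Y j) :=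
      (contDiff_cellWave L m).continuous.comp (continuous_apply j)
    have hduc : Continuous fun Y : Config N => fderiv ℝ u Y (Pi.single j (waveVec L m)) :=
      (hu_cd.continuous_fderiv one_ne_zero).clm_apply continuous_const
    have hφc : Continuous fun Y : Config N => starRingEnd ℂ (φ (densityMode N L m Y)) :=
      Complex.continuous_conj.comp (hφ.continuous.comp hZc)
    exact (hφc.mul (hec.mul ((continuous_const.mul (Complex.continuous_ofReal.comp huc)).sub
      (continuous_const.mul (Complex.continuous_ofReal.comp hduc))))).mul (Complex.continuous_ofReal.comp huc)
  rw [integral_finsetSum _ fun j _ => hint j]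
  simp_rw [stein_step hL m hu_cd hu_per hφ]
  -- resum the second term into `Z_{2m}`
  have hB : ∀ j : Fin N, Integrable (fun X : Config N => starRingEnd ℂ (((fderiv ℝ φ (densityMode N L m X) 1 + Complex.I * fderiv ℝ φ (densityMode N L m X) Complex.I) / 2)) *
      cellWave L ((2 : ℕ) • m) (X j) * ((u X ^ 2 : ℝ) : ℂ)) (volume.restrict (cellN N L)) := by
    intro j
    refine integrableOn_cellN ?_ L
    have he2c : Continuous fun Y : Config N => cellWave L ((2 : ℕ) • m) (Y j) :=
      (contDiff_cellWave L _).continuous.comp (continuous_apply j)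
    exact ((Complex.continuous_conj.comp ((continuous_wirtingerDbar hφ).comp hZc)).mul he2c).mul
      (Complex.continuous_ofReal.comp (huc.pow 2))
  have hsum : ∑ j : Fin N, ∫ X in cellN N L, starRingEnd ℂ (((fderiv ℝ φ (densityMode N L m X) 1 + Complex.I * fderiv ℝ φ (densityMode N L m X) Complex.I) / 2)) *
        cellWave L ((2 : ℕ) • m) (X j) * ((u X ^ 2 : ℝ) : ℂ) =
      ∫ X in cellN N L, starRingEnd ℂ (((fderiv ℝ φ (densityMode N L m X) 1 + Complex.I * fderiv ℝ φ (densityMode N L m X) Complex.I) / 2)) *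
        densityMode N L ((2 : ℕ) • m) X * ((u X ^ 2 : ℝ) : ℂ) := by
    rw [← integral_finsetSum _ fun j _ => hB j]
    refine integral_congr_ae (Filter.Eventually.of_forall fun X => ?_)
    simp only [densityMode, Finset.mul_sum, Finset.sum_mul]
  rw [Finset.sum_sub_distrib, ← Finset.mul_sum, ← Finset.mul_sum, hsum, Finset.sum_const, Finset.card_univ,
    Fintype.card_fin, nsmul_eq_mul]
  ring

/-- **The derivative-free (Stein) form of the lifted Fisher test functional**: for a real periodic `C¹`
state, a `C¹` test field and a mode `m ≠ 0`,
`J_m(φ) = −4 Re ∫ conj(∂φ(Z_m)) |Ψ|² + (4/N) Re ∫ conj(∂̄φ(Z_m)) Z_{2m} |Ψ|² − ∫ |φ(Z_m)|² |Ψ|²`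
— a functional of the joint law of the first two harmonics `(Z_m, Z_{2m})` under `|Ψ|² dX`; no
derivative of `Ψ` appears. -/
theorem fisherTestV_eq_stein : ∀ (n : ℕ) (L : ℝ), 0 < L → ∀ (Ψ : PeriodicTrialState (n + 1) L),
    (∀ X, Ψ.ψ X = (‖Ψ.ψ X‖ : ℂ)) → ∀ (φ : ℂ → ℂ), ContDiff ℝ 1 φ → ∀ (m : Fin 3 → ℤ), m ≠ 0 →
    fisherTestV n L Ψ m φ =
      -4 * (∫ X in cellN (n + 1) L, starRingEnd ℂ (((fderiv ℝ φ (densityMode (n + 1) L m X) 1 - Complex.I * fderiv ℝ φ (densityMode (n + 1) L m X) Complex.I) / 2)) *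
          ((‖Ψ.ψ X‖ ^ 2 : ℝ) : ℂ)).re +
        4 / ((n : ℝ) + 1) * (∫ X in cellN (n + 1) L, starRingEnd ℂ (((fderiv ℝ φ (densityMode (n + 1) L m X) 1 + Complex.I * fderiv ℝ φ (densityMode (n + 1) L m X) Complex.I) / 2)) *
          densityMode (n + 1) L ((2 : ℕ) • m) X * ((‖Ψ.ψ X‖ ^ 2 : ℝ) : ℂ)).re -
        ∫ X in cellN (n + 1) L, ‖φ (densityMode (n + 1) L m X)‖ ^ 2 * ‖Ψ.ψ X‖ ^ 2 := by
  intro n L hL Ψ hreal φ hφ m hm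
  have hk := norm_waveVec_pos hL hm
  have hκ : (‖waveVec L m‖ ^ 2 : ℝ) ≠ 0 := by positivity
  have hN : ((n : ℝ) + 1) ≠ 0 := by positivity
  -- the pairing integrand is continuous, hence integrable, so `∫ Re = Re ∫`
  have hF : Integrable (fun X : Config (n + 1) => starRingEnd ℂ (φ (densityMode (n + 1) L m X)) *
      commutatorAmp (n + 1) L Ψ.ψ m X * starRingEnd ℂ (Ψ.ψ X)) (volume.restrict (cellN (n + 1) L)) := by
    refine integrableOn_cellN ?_ L
    have hZ := continuous_densityMode (n + 1) L m
    have hW := continuous_commutatorAmp (n + 1) L Ψ.contDiff m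
    exact ((Complex.continuous_conj.comp (hφ.continuous.comp hZ)).mul hW).mul
      (Complex.continuous_conj.comp Ψ.contDiff.continuous)
  have hre : (∫ X in cellN (n + 1) L, (starRingEnd ℂ (φ (densityMode (n + 1) L m X)) *
      commutatorAmp (n + 1) L Ψ.ψ m X * starRingEnd ℂ (Ψ.ψ X)).re) =
      (∫ X in cellN (n + 1) L, starRingEnd ℂ (φ (densityMode (n + 1) L m X)) *
        commutatorAmp (n + 1) L Ψ.ψ m X * starRingEnd ℂ (Ψ.ψ X)).re := by
    have h := integral_re hF
    simpa using h
  unfold fisherTestV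
  rw [hre, stein_identity hL Ψ hreal hφ m]
  have hcast : ((n + 1 : ℕ) : ℂ) = ((((n : ℝ) + 1 : ℝ)) : ℂ) := by push_cast; ring
  rw [hcast, Complex.re_ofReal_mul, Complex.sub_re, Complex.re_ofReal_mul]
  field_simp
  ring

end SteinForm

end Summit.AtomisticToContinuum.BoseEinsteinCondensation.Cruxes.InfraredMinimumUncertainty.FisherGaussianDensityMode

end
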